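import Summits.Ventures.PercRepro.S1CoreCapSpecSpreadFour

/-!
# PercRepro — TOWARDS THE INSTANCE `ν = 5` OF THE SPREAD SPEC (`FourCapSpecSpread capPaper 5 8`): RESTRICTION TO A BASE (p1, gen 32)

`proofs/P1-S2-CORANK6.md` §4f–§4g. The search `fourcap_spread3.py` (re-run with `maxlines = 12`: 79 states) reads `Q*_spread(5) = 8`
(against `Q*(5) = 11`), attained by a simple 4-point line beside a disjoint `K₄` triangle system. The proof is a case analysis on the heaviest
line; this module holds what every case uses:
* **restriction** (`cost_clause_restrict`): the lines disjoint from the union of a base list `b` of cost `c = wsum (unionL b) − lineRank b`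
  satisfy the cost clause at nullity `5 − c` (`unionL_append_union`, `lineRank_append_of_disjoint`); with the instances `ν = 3` (`card_le_four`) and
  `ν = 2` (`card_le_two_of_cost_two`) this bounds the number of lines disjoint from a base of cost `2` by `4` and of cost `3` by `2`
  (`card_filter_disjoint_le_four`, `card_filter_disjoint_le_two`);
* **two lines force weight `≤ 4`** under the spread clause at every nullity (`wsum_le_four_of_two_spread`: the two-line list has
  `lineRank ≤ 4`, so `wsum (L' ∪ L) ≤ 7 − |L' ∩ L|`);
* **a base of cost `3` and rank `3` admits no further line meeting it** (`not_meet_of_cost_three`: a simple 3-point line with `o ≥ 1` points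
  on the base gives `lineRank 5 − o ≤ 4` and `9 − o` points, one more than the clause allows);
The counts around a weight-`4` line and around a fat point are `S1CoreCapSpecSpreadFiveHeavy`; the all-simple case is
`S1CoreCapSpecSpreadFiveLines`; the assembly is `S1CoreCapSpecSpreadFiveMain`. Axioms: standard.
-/

namespace PercRepro

namespace S1

namespace FourCap

variable {β : Type} [DecidableEq β]

/-- The union of a concatenation of lists of lines. -/
theorem unionL_append_union (l b : List (Finset β)) : unionL (l ++ b) = unionL l ∪ unionL b := by
  induction l with
  | nil => simp [unionL]
  | cons L l ih => simp [unionL, ih, Finset.union_assoc]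

/-- The union of a list of lines is disjoint from a set when every line is. -/
theorem disjoint_unionL_of_forall {l : List (Finset β)} {U : Finset β} (h : ∀ L ∈ l, Disjoint L U) :
    Disjoint (unionL l) U := by
  rw [Finset.disjoint_left]
  intro v hv hvU
  obtain ⟨L, hL, hvL⟩ := mem_unionL_iff.1 hv
  exact Finset.disjoint_left.1 (h L hL) hvL hvU

/-- **The rank bound is additive over a base**: lines disjoint from the union of `b` add to `lineRank (l ++ b)` exactly what they add
to `lineRank l` (their points on / off the union are unchanged by `b`). -/
theorem lineRank_append_of_disjoint (l b : List (Finset β)) (hd : ∀ L ∈ l, Disjoint L (unionL b)) :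
    lineRank (l ++ b) = lineRank l + lineRank b := by
  induction l with
  | nil => simp [lineRank]
  | cons L l ih =>
    have hL : Disjoint L (unionL b) := hd L List.mem_cons_self
    have ih' := ih (fun L' hL' => hd L' (List.mem_cons_of_mem _ hL'))
    simp only [List.cons_append, lineRank, unionL_append_union]
    rw [ih']
    have e1 : L \ (unionL l ∪ unionL b) = L \ unionL l := by
      ext v
      simp only [Finset.mem_sdiff, Finset.mem_union, not_or]
      constructor
      · rintro ⟨hvL, hv1, _⟩; exact ⟨hvL, hv1⟩
      · rintro ⟨hvL, hv1⟩; exact ⟨hvL, hv1, Finset.disjoint_left.1 hL hvL⟩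
    have e2 : L ∩ (unionL l ∪ unionL b) = L ∩ unionL l := by
      ext v
      simp only [Finset.mem_inter, Finset.mem_union]
      constructor
      · rintro ⟨hvL, hv | hv⟩
        · exact ⟨hvL, hv⟩
        · exact absurd hv (Finset.disjoint_left.1 hL hvL)
      · rintro ⟨hvL, hv⟩; exact ⟨hvL, Or.inl hv⟩
    rw [e1, e2]
    omega

section Base

variable {w : β → ℕ} {ls : Finset (Finset β)}
  (h1 : ∀ L ∈ ls, ∀ v ∈ L, w v = 1 ∨ w v = 2)
  (h2 : ∀ L ∈ ls, 3 ≤ L.card ∧ wsum w L ≤ 5)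
  (h3 : ∀ L ∈ ls, ∀ L' ∈ ls, L ≠ L' → (L ∩ L').card ≤ 1)
  (h4 : ∀ l : List (Finset β), l.Nodup → (∀ L ∈ l, L ∈ ls) → wsum w (unionL l) ≤ 5 + lineRank l)
  (h7 : ∀ l : List (Finset β), l.Nodup → (∀ L ∈ l, L ∈ ls) → lineRank l ≤ 4 → wsum w (unionL l) ≤ lineRank l + 3)

include h4 in
/-- **Restriction of the cost clause**: if the base list `b` has `5 + lineRank b ≤ ν' + wsum (unionL b)` (cost `≥ 5 − ν'`), every list of
lines of the configuration disjoint from `unionL b` (and not in `b`) satisfies the cost clause at nullity `ν'`. -/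
theorem cost_clause_restrict {b : List (Finset β)} (hb : b.Nodup) (hbl : ∀ L ∈ b, L ∈ ls) {ν' : ℕ}
    (hcost : 5 + lineRank b ≤ ν' + wsum w (unionL b)) (l : List (Finset β)) (hl : l.Nodup) (hll : ∀ L ∈ l, L ∈ ls)
    (hdisj : ∀ L ∈ l, Disjoint L (unionL b)) (hnot : ∀ L ∈ l, L ∉ b) : wsum w (unionL l) ≤ ν' + lineRank l := by
  have hnd : (l ++ b).Nodup := by
    rw [List.nodup_append']
    exact ⟨hl, hb, hnot⟩
  have hc := h4 (l ++ b) hnd (by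
    intro L hL
    rw [List.mem_append] at hL
    rcases hL with h | h
    · exact hll L h
    · exact hbl L h)
  rw [unionL_append_union, wsum_union_of_disjoint w (disjoint_unionL_of_forall hdisj), lineRank_append_of_disjoint l b hdisj] at hc
  omega

include h1 h2 h3 in
/-- **At nullity `2` a configuration has at most two lines** (three lines cost `≥ 3`: the ordering adds `≥ 3, ≥ 2, ≥ 1` points against
rank increments `2, ≤ 1, ≤ 0` beyond the intersections). -/
theorem card_le_two_of_cost_two
    (h4' : ∀ l : List (Finset β), l.Nodup → (∀ L ∈ l, L ∈ ls) → wsum w (unionL l) ≤ 2 + lineRank l) : ls.card ≤ 2 := by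
  by_contra hlt
  push Not at hlt
  obtain ⟨L, L', L'', hL, hL', hL'', hne, hne', hne''⟩ := Finset.two_lt_card_iff.1 hlt
  have h := three_line_cost h4' hL hL' hL'' hne.symm hne'.symm hne''.symm
  have hint : (L' ∩ L).card ≤ 1 := h3 L' hL' L hL hne.symm
  have h3L := (h2 L hL).1
  have h3L' := (h2 L' hL').1
  have h3L'' := (h2 L'' hL'').1
  have hj : (L'' ∩ (L' ∪ L)).card ≤ 2 := by
    rw [Finset.inter_union_distrib_left]
    refine (Finset.card_union_le _ _).trans ?_
    have := h3 L'' hL'' L' hL' hne''.symm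
    have := h3 L'' hL'' L hL hne'.symm
    omega
  have hsd : (L'' \ (L' ∪ L)).card + (L'' ∩ (L' ∪ L)).card = L''.card := Finset.card_sdiff_add_card_inter _ _
  have hsd1 : (L' \ L).card + (L' ∩ L).card = L'.card := Finset.card_sdiff_add_card_inter _ _
  have hwu : wsum w (L'' ∪ (L' ∪ L)) = wsum w (L' ∪ L) + wsum w (L'' \ (L' ∪ L)) := by
    rw [Finset.union_comm]; exact (wsum_union_ge w _ _).symm
  have hwu' : wsum w (L' ∪ L) = wsum w L + wsum w (L' \ L) := by
    rw [Finset.union_comm]; exact (wsum_union_ge w _ _).symm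
  have hc : (L'' \ (L' ∪ L)).card ≤ wsum w (L'' \ (L' ∪ L)) :=
    card_le_wsum w _ (fun v hv => h1 L'' hL'' v (Finset.mem_sdiff.1 hv).1)
  have hc' : (L' \ L).card ≤ wsum w (L' \ L) :=
    card_le_wsum w _ (fun v hv => h1 L' hL' v (Finset.mem_sdiff.1 hv).1)
  have hcL : L.card ≤ wsum w L := card_le_wsum w L (h1 L hL)
  omega

include h2 in
/-- A line of the base is not disjoint from the union of the base. -/
theorem not_disjoint_unionL_of_mem {b : List (Finset β)} (hbl : ∀ L ∈ b, L ∈ ls) {L : Finset β} (hL : L ∈ b)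
    (hd : Disjoint L (unionL b)) : False := by
  have h3L := (h2 L (hbl L hL)).1
  obtain ⟨v, hv⟩ := Finset.card_pos.1 (by omega : 0 < L.card)
  exact Finset.disjoint_left.1 hd hv (mem_unionL_iff.2 ⟨L, hL, hv⟩)

include h1 h2 h3 h4 in
/-- **A base of cost `≥ 2` leaves room for at most four lines disjoint from it** (`card_le_four` at nullity `3`). -/
theorem card_filter_disjoint_le_four {b : List (Finset β)} (hb : b.Nodup) (hbl : ∀ L ∈ b, L ∈ ls)
    (hcost : 5 + lineRank b ≤ 3 + wsum w (unionL b)) :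
    (ls.filter (fun L => Disjoint L (unionL b))).card ≤ 4 := by
  have hD : ∀ L ∈ ls.filter (fun L => Disjoint L (unionL b)), L ∈ ls ∧ Disjoint L (unionL b) :=
    fun L hL => Finset.mem_filter.1 hL
  refine card_le_four (fun L hL => h1 L (hD L hL).1) (fun L hL => h2 L (hD L hL).1)
    (fun L hL L' hL' hne => h3 L (hD L hL).1 L' (hD L' hL').1 hne) ?_
  intro l hl hll
  refine cost_clause_restrict h4 hb hbl hcost l hl (fun L hL => (hD L (hll L hL)).1) (fun L hL => (hD L (hll L hL)).2) ?_
  intro L hL hLb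
  exact not_disjoint_unionL_of_mem h2 hbl hLb (hD L (hll L hL)).2

include h1 h2 h3 h4 in
/-- **A base of cost `≥ 3` leaves room for at most two lines disjoint from it** (`card_le_two_of_cost_two`). -/
theorem card_filter_disjoint_le_two {b : List (Finset β)} (hb : b.Nodup) (hbl : ∀ L ∈ b, L ∈ ls)
    (hcost : 5 + lineRank b ≤ 2 + wsum w (unionL b)) :
    (ls.filter (fun L => Disjoint L (unionL b))).card ≤ 2 := by
  have hD : ∀ L ∈ ls.filter (fun L => Disjoint L (unionL b)), L ∈ ls ∧ Disjoint L (unionL b) :=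
    fun L hL => Finset.mem_filter.1 hL
  refine card_le_two_of_cost_two (fun L hL => h1 L (hD L hL).1) (fun L hL => h2 L (hD L hL).1)
    (fun L hL L' hL' hne => h3 L (hD L hL).1 L' (hD L' hL').1 hne) ?_
  intro l hl hll
  refine cost_clause_restrict h4 hb hbl hcost l hl (fun L hL => (hD L (hll L hL)).1) (fun L hL => (hD L (hll L hL)).2) ?_
  intro L hL hLb
  exact not_disjoint_unionL_of_mem h2 hbl hLb (hD L (hll L hL)).2

include h1 h2 h3 h7 in
/-- **Two lines force weight `≤ 4` under the spread clause** (at every nullity): the two-line list has `lineRank ≤ 4 − |L' ∩ L|`, so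
`wsum (L' ∪ L) ≤ 7 − |L' ∩ L|`, while `L'` adds `≥ 3 − |L' ∩ L|` to `wsum L`. -/
theorem wsum_le_four_of_two_spread {L L' : Finset β} (hL : L ∈ ls) (hL' : L' ∈ ls) (hne : L' ≠ L) : wsum w L ≤ 4 := by
  have hint : (L' ∩ L).card ≤ 1 := h3 L' hL' L hL hne
  have h3L' := (h2 L' hL').1
  have hsd : (L' \ L).card + (L' ∩ L).card = L'.card := Finset.card_sdiff_add_card_inter _ _
  have hr : min L.card 2 + min (L' \ L).card (2 - min (L' ∩ L).card 2) ≤ 4 := by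
    have : min L.card 2 ≤ 2 := min_le_right _ _
    have : min (L' \ L).card (2 - min (L' ∩ L).card 2) ≤ 2 - min (L' ∩ L).card 2 := min_le_right _ _
    omega
  have hc := two_line_spread h7 hL hL' hne hr
  have hwu : wsum w (L' ∪ L) = wsum w L + wsum w (L' \ L) := by
    rw [Finset.union_comm]; exact (wsum_union_ge w _ _).symm
  have hc' : (L' \ L).card ≤ wsum w (L' \ L) :=
    card_le_wsum w _ (fun v hv => h1 L' hL' v (Finset.mem_sdiff.1 hv).1)
  have : min (L' \ L).card (2 - min (L' ∩ L).card 2) ≤ 2 - min (L' ∩ L).card 2 := min_le_right _ _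
  have : min L.card 2 ≤ 2 := min_le_right _ _
  omega

include h1 h7 in
/-- **A base of cost `3` and rank `3` admits no further line meeting it**: a simple 3-point line `Y` with `o ≥ 1` points on the base's
union (`o ≤ 2`) gives the list `Y :: b` the rank bound `3 + (2 − o) ≤ 4` and `9 − o` points, against the clause's `8 − o`. -/
theorem not_meet_of_cost_three {b : List (Finset β)} (hb : b.Nodup) (hbl : ∀ L ∈ b, L ∈ ls)
    (hrank : lineRank b = 3) (hwb : wsum w (unionL b) = 6) {Y : Finset β} (hY : Y ∈ ls) (hYb : Y ∉ b)
    (hc : Y.card = 3) (hwY : wsum w Y = 3) (hmeet : (Y ∩ unionL b).Nonempty) (ho : (Y ∩ unionL b).card ≤ 2) : False := by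
  have hnd : (Y :: b).Nodup := List.nodup_cons.2 ⟨hYb, hb⟩
  have hmem : ∀ L ∈ Y :: b, L ∈ ls := by
    intro L hL
    rw [List.mem_cons] at hL
    rcases hL with rfl | hL
    · exact hY
    · exact hbl L hL
  obtain ⟨a1, b1, c1, d1⟩ := cost_step w Y b (fun v hv => by rcases h1 Y hY v hv with h | h <;> omega)
  have hpos : 1 ≤ (Y ∩ unionL b).card := Finset.card_pos.2 hmeet
  have hfY : fat w Y = 0 := by
    have := wsum_eq_card_add_fat w Y (h1 Y hY); omega
  have hwsd : wsum w (Y \ unionL b) = (Y \ unionL b).card := by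
    have := wsum_sdiff_eq w Y (unionL b) (h1 Y hY)
    have := fat_mono w (Finset.sdiff_subset : Y \ unionL b ⊆ Y)
    omega
  have hr : lineRank (Y :: b) ≤ 4 := by
    rw [c1, hrank]
    have : min (Y \ unionL b).card (2 - min (Y ∩ unionL b).card 2) ≤ 2 - min (Y ∩ unionL b).card 2 := min_le_right _ _
    omega
  have hsp := h7 (Y :: b) hnd hmem hr
  rw [c1, hrank] at hsp
  rw [a1, hwb, hwsd] at hsp
  omega

end Base

end FourCap

end S1

end PercRepro
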